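import Summits.Ventures.PercRepro.Night2DQm1Loss
import Summits.Ventures.PercRepro.Night2LocalTopLevels
import Summits.Ventures.PercRepro.Night2RigidMass

/-!
# PercRepro — the regime `|E ∖ G| = q − 1`: residual capacity and loss mass of the targets (night-2, gen 19)

With `ρ = q + 1 − kColoops`, a shadow set `S` with `|S ∖ K| ≥ ρ + 1` has at most `ρ − 2` thin covering preimages
(`card_thin_coverPreimages_add_two_le`), so `L1 S ≤ (ρ − 2)Φ/(q+1)` and the residual capacity after layers 0 and 1 is
at least `cPrimeDQ q ρ k = capDQ q k − (ρ − 2)Φ/(q+1) = (ρ(q+2) − 2)/(q(q+1)²) > 0` (**`cap2_ge_cPrimeDQ`**).  At the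
top two levels `|G ∖ S| ≤ 1` the residual capacity is `1` (`cap2_eq_one_of_card_le`, `Night2LocalTopLevels`,
restated here as `cap2_eq_one_of_card_sdiff_le_one`).  These are the size-only bounds `v` of the cell proofs
(`proofs/NIGHT-2-g19.md` §2).

## The loss mass of a target


With `ρ = q + 1 − kColoops` the losses sit at the hyperplane-basis members `B = K ∪ T`, `|T| = ρ − 1`
(`loss_eq_zero_of_card_ge_dqm1`), each at most `lambdaDQ` (`loss_le_lambdaDQ`), and every such member has
`2^{n−ρ} − 1` targets (`card_tgtSets`, `n = |G ∖ K|`).  The pairs `(B, z)` whose loss targets a shadow set `S`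
inject into the pointed `ρ`-subsets `(Q, w)` of `S ∖ K` (`Q = T ∪ {z}`, `w = z`; `lossPairs_inj`), so
**`pi2Mass_le_dqm1`**: `pi2Mass S ≤ ρ·C(|S ∖ K|, ρ)·λ/(2^{n−ρ} − 1)` — the size-only bound `u` of the cell proofs
(`proofs/NIGHT-2-g19.md` §2; for `ρ = 3` this is `pi2Mass_le_rigid`).
-/

namespace PercRepro.Shadow

open Finset PerFlat ThmH

variable {α : Type*} [DecidableEq α] {M : Matroid α} [M.Finite]

/-- The residual capacity bound of the middle targets: `c′ = capDQ − (ρ − 2)Φ/(q+1)`. -/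
noncomputable def cPrimeDQ (q ρ k : ℕ) : ℚ := capDQ q k - ((ρ : ℚ) - 2) * (phiQ q / ((q : ℚ) + 1))

/-- `c′ = (ρ(q+2) − 2)/(q(q+1)²)` when `k + ρ = q + 1`, `q ≥ 1`. -/
theorem cPrimeDQ_eq {q ρ k : ℕ} (hk : k + ρ = q + 1) (hq : 1 ≤ q) :
    cPrimeDQ q ρ k = ((ρ : ℚ) * ((q : ℚ) + 2) - 2) / ((q : ℚ) * ((q : ℚ) + 1) ^ 2) := by
  unfold cPrimeDQ capDQ phiQ
  have hqq : (1 : ℚ) ≤ (q : ℚ) := by exact_mod_cast hq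
  have hkρ : (k : ℚ) = (q : ℚ) + 1 - (ρ : ℚ) := by
    have : (k : ℚ) + (ρ : ℚ) = (q : ℚ) + 1 := by exact_mod_cast hk
    linarith
  rw [hkρ]
  have hq0 : (q : ℚ) ≠ 0 := by positivity
  have hq1 : (q : ℚ) + 1 ≠ 0 := by positivity
  field_simp
  ring

/-- `c′ > 0` when `k + ρ = q + 1`, `q ≥ 1`, `ρ ≥ 1`. -/
theorem cPrimeDQ_pos {q ρ k : ℕ} (hk : k + ρ = q + 1) (hq : 1 ≤ q) (hρ : 1 ≤ ρ) : 0 < cPrimeDQ q ρ k := by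
  rw [cPrimeDQ_eq hk hq]
  have hqq : (1 : ℚ) ≤ (q : ℚ) := by exact_mod_cast hq
  have hρρ : (1 : ℚ) ≤ (ρ : ℚ) := by exact_mod_cast hρ
  apply div_pos _ (by positivity)
  nlinarith

open scoped Classical in
/-- **`cap2 S ≥ c′` at every shadow set with `|S ∖ K| ≥ ρ + 1`** (`|E ∖ G| = q − 1`, `M` simple loopless). -/
theorem cap2_ge_cPrimeDQ {q ρ : ℕ} {G : Finset α} (hG : G ∈ flatsQ M (q + 1))
    (hd : (gr M \ G).card = q - 1) (hk : kColoops M G + ρ = q + 1)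
    (hs : ∀ e ∈ gr M, ∀ f ∈ gr M, e ≠ f → rkN M {e, f} = 2) (hl : ∀ e ∈ gr M, M.Indep {e}) {S : Finset α}
    (hS : S ∈ shadowAt M (q + 2) q (Uq M (q + 2) q) G) (hcard : ρ + 1 ≤ (S \ coloops M G).card) :
    cPrimeDQ q ρ (kColoops M G) ≤ cap2 M q G S := by
  have hd' : (gr M \ G).card ≤ q := by omega
  have hq1 : 1 ≤ q := by
    obtain ⟨B, hB⟩ := (mem_shadow.1 (mem_shadowAt.1 hS).1).2
    exact le_trans (one_le_card_compl_of_member hG hB.1) hd'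
  unfold cPrimeDQ
  have h1 := cap2_ge_capS_sub_L1_of_le hG hd' S
  have h2 := capS_ge_capDQ hd hq1 (subset_G_of_mem_shadowAt hS)
  have h3 := L1_le_of_card_ge_dqm1 hG hd hk hs hl hS hcard
  linarith

open scoped Classical in
/-- At a shadow set with `|G ∖ S| ≤ 1` the residual capacity is `1` (`|E ∖ G| = q − 1`). -/
theorem cap2_eq_one_of_card_sdiff_le_one {q : ℕ} {G : Finset α} (hG : G ∈ flatsQ M (q + 1))
    (hd : (gr M \ G).card = q - 1) (hq : 1 ≤ q) {S : Finset α} (h1 : (G \ S).card ≤ 1) : cap2 M q G S = 1 :=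
  cap2_eq_one_of_card_le hG (by rw [hd]; omega)


/-! ## The loss mass of a target -/

/-- A thin member with `|B ∖ K| + 1 = ρ` has `|G ∖ (B ∪ {z})| = n − ρ` with `n = |G| − kColoops`. -/
theorem card_sdiff_insert_eq_dqm1 {q ρ : ℕ} {G : Finset α} (hG : G ∈ flatsQ M (q + 1))
    (hd : (gr M \ G).card ≤ q) {B : Finset α} (hB : B ∈ thinMembers M q G)
    (hcard : (B \ coloops M G).card + 1 = ρ) {z : α} (hz : z ∈ G \ clF M B) :
    (G \ insert z B).card = (G.card - kColoops M G) - ρ := by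
  have hB' : B ∈ membersIn M (Uq M (q + 2) q) G := (mem_thinMembers.1 hB).1
  have hBU : B ∈ Uq M (q + 2) q := (mem_membersIn.1 hB').1
  have hBG : B ⊆ G := (subset_clF hBU).trans (mem_membersIn.1 hB').2
  have hK := coloops_subset_of_mem_thinMembers hG hd hB
  have hzB : z ∉ B := notMem_of_notMem_clF hBU (Finset.mem_sdiff.1 hz).2
  have hzG : z ∈ G := (Finset.mem_sdiff.1 hz).1
  have hBcard : B.card = kColoops M G + (B \ coloops M G).card := by
    rw [kColoops_eq_card_coloops, ← Finset.card_union_of_disjoint Finset.disjoint_sdiff,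
      Finset.union_sdiff_of_subset hK]
  have hKG : kColoops M G ≤ G.card := by
    rw [kColoops_eq_card_coloops]; exact Finset.card_le_card (hK.trans hBG)
  have hBG' : B.card ≤ G.card := Finset.card_le_card hBG
  rw [Finset.card_sdiff_of_subset (Finset.insert_subset hzG hBG), Finset.card_insert_of_notMem hzB, hBcard]
  omega

open scoped Classical in
/-- A loss pair with positive weight is a hyperplane-basis member: `|B ∖ K| + 1 = ρ`. -/
theorem card_sdiff_add_one_eq_of_rhoL_ne_zero {q ρ : ℕ} {G : Finset α} (hG : G ∈ flatsQ M (q + 1))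
    (hd : (gr M \ G).card = q - 1) (hk : kColoops M G + ρ = q + 1) (hρ : 1 ≤ ρ)
    (hs : ∀ e ∈ gr M, ∀ f ∈ gr M, e ≠ f → rkN M {e, f} = 2) (hl : ∀ e ∈ gr M, M.Indep {e})
    {B : Finset α} (hB : B ∈ thinMembers M q G) {z : α} (hz : z ∈ G \ clF M B)
    (hρ' : rhoL M q G B z ≠ 0) : (B \ coloops M G).card + 1 = ρ := by
  have hd' : (gr M \ G).card ≤ q := by omega
  have hloss : loss M q G B z ≠ 0 := by
    intro h; apply hρ'; unfold rhoL; rw [h, zero_div]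
  have hge := card_sdiff_coloops_thin_ge hG hd' hk hB
  by_contra hne
  exact hloss (loss_eq_zero_of_card_ge_dqm1 hG hd hk hρ hs hl hB (by omega) hz)

open scoped Classical in
/-- **The loss mass of a shadow set `S` is at most `ρ·C(|S ∖ K|, ρ)·λ/(2^{n−ρ} − 1)`** (`|E ∖ G| = q − 1`,
`kColoops + ρ = q + 1`, `M` simple loopless). -/
theorem pi2Mass_le_dqm1 {q ρ : ℕ} {G : Finset α} (hG : G ∈ flatsQ M (q + 1)) (hd : (gr M \ G).card = q - 1)
    (hk : kColoops M G + ρ = q + 1) (hρ : 2 ≤ ρ) (hs : ∀ e ∈ gr M, ∀ f ∈ gr M, e ≠ f → rkN M {e, f} = 2)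
    (hl : ∀ e ∈ gr M, M.Indep {e}) {S : Finset α} (hS : S ∈ shadowAt M (q + 2) q (Uq M (q + 2) q) G) :
    pi2Mass M q G S ≤
      ((ρ : ℚ) * ((S \ coloops M G).card.choose ρ : ℚ)) *
        (lambdaDQ q ρ (kColoops M G) / ((2 ^ ((G.card - kColoops M G) - ρ) - 1 : ℕ) : ℚ)) := by
  have hd' : (gr M \ G).card ≤ q := by omega
  have hq1 : 1 ≤ q := by
    obtain ⟨B, hB⟩ := (mem_shadow.1 (mem_shadowAt.1 hS).1).2
    exact le_trans (one_le_card_compl_of_member hG hB.1) hd'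
  rw [pi2Mass_eq_sum_lossPairsAt]
  set r := (G.card - kColoops M G) - ρ with hr
  set w : ℚ := lambdaDQ q ρ (kColoops M G) / ((2 ^ r - 1 : ℕ) : ℚ) with hw
  have hw0 : 0 ≤ w := by
    rw [hw]; exact div_nonneg (lambdaDQ_pos hk hq1 (by omega)).le (by positivity)
  have hterm : ∀ p ∈ lossPairsAt M q G S, rhoL M q G p.1 p.2 ≤
      if rhoL M q G p.1 p.2 = 0 then 0 else w := by
    intro p hp
    split_ifs with h0
    · rw [h0]
    · unfold lossPairsAt at hp
      rw [Finset.mem_filter, Finset.mem_image] at hp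
      obtain ⟨⟨x, hx, rfl⟩, hpS⟩ := hp
      rw [Finset.mem_sigma] at hx
      obtain ⟨hB, hz⟩ := hx
      have h2 := card_sdiff_add_one_eq_of_rhoL_ne_zero hG hd hk (by omega) hs hl hB hz h0
      unfold rhoL
      rw [card_tgtSets hG (mem_thinMembers.1 hB).1 hz, card_sdiff_insert_eq_dqm1 hG hd' hB h2 hz, ← hr, hw]
      apply div_le_div_of_nonneg_right _ (by positivity)
      exact loss_le_lambdaDQ hG hd hk hρ hB h2 hz
  calc ∑ p ∈ lossPairsAt M q G S, rhoL M q G p.1 p.2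
      ≤ ∑ p ∈ lossPairsAt M q G S, (if rhoL M q G p.1 p.2 = 0 then 0 else w) := Finset.sum_le_sum hterm
    _ = ((lossPairsAt M q G S).filter (fun p => rhoL M q G p.1 p.2 ≠ 0)).card * w := by
        rw [Finset.sum_ite, Finset.sum_const_zero, zero_add, Finset.sum_const, nsmul_eq_mul]
    _ ≤ ((ρ : ℚ) * ((S \ coloops M G).card.choose ρ : ℚ)) * w := by
        apply mul_le_mul_of_nonneg_right _ hw0
        -- inject into the pointed ρ-subsets of S ∖ K
        have hinj : ((lossPairsAt M q G S).filter (fun p => rhoL M q G p.1 p.2 ≠ 0)).card ≤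
            (((S \ coloops M G).powersetCard ρ).sigma (fun T => T)).card := by
          apply Finset.card_le_card_of_injOn (fun p => ⟨insert p.2 (p.1 \ coloops M G), p.2⟩)
          · intro p hp
            rw [Finset.mem_coe, Finset.mem_filter] at hp
            obtain ⟨hp, hρ'⟩ := hp
            unfold lossPairsAt at hp
            rw [Finset.mem_filter, Finset.mem_image] at hp
            obtain ⟨⟨x, hx, rfl⟩, hpS⟩ := hp
            rw [Finset.mem_sigma] at hx
            obtain ⟨hB, hz⟩ := hx
            have h2 := card_sdiff_add_one_eq_of_rhoL_ne_zero hG hd hk (by omega) hs hl hB hz hρ'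
            have hB' : x.1 ∈ membersIn M (Uq M (q + 2) q) G := (mem_thinMembers.1 hB).1
            have hBU : x.1 ∈ Uq M (q + 2) q := (mem_membersIn.1 hB').1
            have hzB : x.2 ∉ x.1 := notMem_of_notMem_clF hBU (Finset.mem_sdiff.1 hz).2
            have hzK : x.2 ∉ x.1 \ coloops M G := fun hh => hzB (Finset.mem_sdiff.1 hh).1
            have hsub : insert x.2 x.1 ⊆ S := (mem_tgtSets.1 hpS).2.1
            rw [Finset.mem_coe, Finset.mem_sigma, Finset.mem_powersetCard]
            refine ⟨⟨?_, ?_⟩, Finset.mem_insert_self _ _⟩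
            · intro y hy
              rw [Finset.mem_insert] at hy
              rw [Finset.mem_sdiff]
              rcases hy with rfl | hy
              · refine ⟨hsub (Finset.mem_insert_self _ _), ?_⟩
                intro hzc
                exact hzB (coloops_subset_of_mem_thinMembers hG hd' hB hzc)
              · rw [Finset.mem_sdiff] at hy
                exact ⟨hsub (Finset.mem_insert_of_mem hy.1), hy.2⟩
            · rw [Finset.card_insert_of_notMem hzK, h2]
          · intro p hp p' hp' heq
            rw [Finset.mem_coe, Finset.mem_filter] at hp hp'
            obtain ⟨hp, -⟩ := hp
            obtain ⟨hp', -⟩ := hp'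
            unfold lossPairsAt at hp hp'
            rw [Finset.mem_filter, Finset.mem_image] at hp hp'
            obtain ⟨⟨x, hx, rfl⟩, -⟩ := hp
            obtain ⟨⟨x', hx', rfl⟩, -⟩ := hp'
            rw [Finset.mem_sigma] at hx hx'
            simp only [Sigma.mk.injEq] at heq
            obtain ⟨hT, hzz⟩ := heq
            have hzz' : x.2 = x'.2 := eq_of_heq hzz
            have hBU : x.1 ∈ Uq M (q + 2) q := (mem_membersIn.1 (mem_thinMembers.1 hx.1).1).1
            have hBU' : x'.1 ∈ Uq M (q + 2) q := (mem_membersIn.1 (mem_thinMembers.1 hx'.1).1).1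
            have hB := lossPairs_inj hG hd' hx.1 hx'.1 hT hzz'
              (notMem_of_notMem_clF hBU (Finset.mem_sdiff.1 hx.2).2)
              (notMem_of_notMem_clF hBU' (Finset.mem_sdiff.1 hx'.2).2)
            exact Prod.ext hB hzz'
        have hcount : (((S \ coloops M G).powersetCard ρ).sigma (fun T => T)).card =
            ρ * (S \ coloops M G).card.choose ρ := by
          rw [Finset.card_sigma]
          have : ∀ T ∈ (S \ coloops M G).powersetCard ρ, T.card = ρ :=
            fun T hT => (Finset.mem_powersetCard.1 hT).2
          rw [Finset.sum_congr rfl this, Finset.sum_const, Finset.card_powersetCard, smul_eq_mul, mul_comm]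
        have := hinj.trans hcount.le
        exact_mod_cast this

end PercRepro.Shadow
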